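import Literature.Geometry.Lorentzian.CoordRicciEvolution
import Literature.Geometry.Lorentzian.CoordEntropyEvolution
import Literature.Geometry.Lorentzian.CoordPairingDerivQuadratic
import Literature.Geometry.Lorentzian.CoordScalarCurvatureEvolution
import Literature.Geometry.Lorentzian.CoordScalarCurvatureFirstVariation
import Literature.Geometry.Lorentzian.CoordScalarCurvatureAdjoint
import HarnessLib

/-!
# The Bochner formula for a field of symmetric forms and the evolution of `|Ric|²` under the
# Ricci flow, in coordinates (Hamilton 1982, §7 and Lemma 11.2)

A further layer of the coordinate tensor calculus of `MetricCoord` (`CoordCurvature`,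
`CoordBianchi`, `CoordRicciEvolution`, `CoordPairingDerivQuadratic`,
`CoordScalarCurvatureFirstVariation`): metric components `G : E → (E →L E →L ℝ)`, smooth,
symmetric and nondegenerate on an open set `V` (`IsMetricOn G V`), `♯ = sharpAt G`, inverse metric
coefficients `g^{ij} = ginv G b` in a basis `b`, metric pairing of bilinear forms
`⟨α, β⟩_G = pairAt G x α β = tr((♯α)(♯β))`, `|β|²_G = normSqAt`, covariant derivatives `cov₂At`,
`cov₃At`, rough Laplacian `Δβ = lapBilinAt G β`, Laplace–Beltrami operator `Δ = lapAt G`.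

Support file for Hamilton's gradient estimate for the scalar curvature (Hamilton 1982, §11,
Thm. 11.1, the quantity `|∇S|²/S + N|E|²`), used by the crux `ChangGurskyYang` of the route
SmoothPoincare4/EntropyRung (item stmt-SmoothPoincare4-10834, line margerin-cone-hamilton-rails,
stub `stub_gradientEstimates`). We prove:

* `IsMetricOn.lapAt_normSqAt` — the **Bochner formula for a smooth field of symmetric forms**
  `Δ|β|² = 2|∇β|² + 2⟨β, Δβ⟩`, with `|∇β|²_x = Σ_{kl} g^{kl}⟨∇_{b_k}β, ∇_{b_l}β⟩_G`
  (Hamilton 1982, §7: contractions commute with `∇`; here from `IsMetricOn.lapAt_quadratic`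
  with `c = 0`);
* `IsMetricFamilyOn.hasDerivWithinAt_normSqAt_ricAt_ricciFlow` — **Hamilton 1982, Lemma 11.2**:
  for a smooth one-parameter family of metric components on `V × S` satisfying the Ricci flow in
  coordinates `∂G/∂t = −2 Ric(G)`, at `t ∈ S`, `x ∈ V`,

    `∂ₜ|Ric|² = Δ|Ric|² − 2|∇Ric|² + 4 B(Ric, Ric)`,

  where `B_x(β, γ) = Σᵢⱼ g^{ij} Σ_k bᵏ(♯((β.flip bⱼ) ∘ R(bᵢ, ♯(γ b_k))))`
  `= Σ g^{ij}⟨β(R(bᵢ,·)·, bⱼ), γ⟩` is the curvature pairing (the `Rm ∗ Ric` term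
  `2 g^{pr}g^{qs}R_{piqk}R_{rs}` of Hamilton 1982, Cor. 7.3 / Topping 2006, (2.5.4), paired with
  `γ`), written out in the basis; the derivative is within `S` (valid up to the end points of a
  closed time interval);
* helpers: `pairAt_sum_right`, `eq_sum_smul_coordCLM_smulRight` (expansion of a bilinear form in
  the dual basis); the pairing in a basis `⟨α,β⟩ = Σ g^{kl} α(♯(β b_k), b_l)` is
  `pairAt_eq_sum_ginv` of `CoordScalarCurvatureAdjoint`.

## Proof of Lemma 11.2 (Hamilton 1982, §11, from Cor. 7.3)

By `IsMetricFamilyOn.hasDerivWithinAt_normSqAt` (Topping 2006, §2.3.2),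
`∂ₜ|K|² = 2⟨K̇, K⟩ − 2 tr(♯h ♯K ♯K)` for the family `K_s = Ric(G s)_x` with `h = ∂ₜG = −2 Ric`; a
derivative `K̇ = κ` with values in bilinear maps exists by expanding `Ric` in the dual basis, and
its components are, by uniqueness of derivatives within `S`, those of Hamilton's Cor. 7.3
(`IsMetricFamilyOn.hasDerivWithinAt_ricAt_ricciFlow'`):
`κ(Y,Z) = ΔRic(Y,Z) + 2Σ g^{ij}Ric(R(bᵢ,Y)Z, bⱼ) − 2Σ g^{kl}Ric(Y,b_k)Ric(Z,b_l)`. Pairing with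
`Ric`: the last term is `Ric ∘ ♯ ∘ Ric`, whose pairing with `Ric` is `tr((♯Ric)³)` and cancels
against `−2 tr(♯h ♯Ric ♯Ric) = 4 tr((♯Ric)³)`; the middle term gives `4B(Ric,Ric)`; and
`2⟨ΔRic, Ric⟩ = Δ|Ric|² − 2|∇Ric|²` by the Bochner formula. Everything is proved; no definition
and no statement of `Prop` type is introduced.

## References

* R. S. Hamilton, *Three-manifolds with positive Ricci curvature*, J. Differential Geom. 17
  (1982), 255–306, §7 (Cor. 7.3, Lemma 7.4), §10, §11 (Thm. 11.1, Lemmas 11.2–11.6). [Hamilton1982]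
* G. Huisken, *Ricci deformation of the metric on a Riemannian manifold*, J. Differential Geom. 21
  (1985), 47–62, §4. [Huisken1985]
* B. O'Neill, *Semi-Riemannian geometry with applications to relativity*, Academic Press 1983,
  Ch. 3 (pp. 60–61, 86; Lemma 3.52). [ONeill1983]
* P. Topping, *Lectures on the Ricci flow*, LMS Lecture Note Series 325, CUP 2006, §2
  (§2.1, §2.3.2, Prop. 2.5.3, (2.5.4)). [Topping2006]
-/

noncomputable section

set_option maxSynthPendingDepth 3

open Set Filter ContinuousLinearMap Module
open scoped Topology ContDiff

namespace Literature.Geometry.Lorentzian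

namespace MetricCoord

variable {E : Type*} [NormedAddCommGroup E] [NormedSpace ℝ E] [FiniteDimensional ℝ E]
  [CompleteSpace E]

/-! ### Algebraic helpers: sums in the pairing, expansion in the dual basis -/

section Helpers

variable (G : E → E →L[ℝ] E →L[ℝ] ℝ) {ι : Type*} [Fintype ι] (b : Basis ι ℝ E)

omit [CompleteSpace E] [Fintype ι] in
/-- The pairing is additive over finite sums in the second slot. [folklore] -/
theorem pairAt_sum_right (x : E) (α : E →L[ℝ] E →L[ℝ] ℝ) (s : Finset ι)
    (f : ι → E →L[ℝ] E →L[ℝ] ℝ) :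
    pairAt G x α (∑ i ∈ s, f i) = ∑ i ∈ s, pairAt G x α (f i) := by
  simp only [pairAt_apply, ContinuousLinearMap.comp_finsetSum, map_sum]

omit [CompleteSpace E] in
/-- Expansion of a bilinear form in the dual basis: `β = Σ_{ac} β(b_a, b_c) bᵃ ⊗ bᶜ`. [folklore] -/
theorem eq_sum_smul_coordCLM_smulRight (β : E →L[ℝ] E →L[ℝ] ℝ) :
    β = ∑ a, ∑ c, β (b a) (b c) • (coordCLM b a).smulRight (coordCLM b c) := by
  ext v w
  simp only [FunLike.coe_sum, Finset.sum_apply, _root_.smul_apply,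
    ContinuousLinearMap.smulRight_apply, coordCLM_apply, smul_eq_mul]
  have hv : β v w = ∑ a, b.coord a v * β (b a) w := by
    conv_lhs => rw [← b.sum_repr v]
    simp only [map_sum, map_smul, FunLike.coe_sum, Finset.sum_apply, _root_.smul_apply,
      smul_eq_mul, Basis.coord_apply]
  rw [hv]
  refine Finset.sum_congr rfl fun a _ ↦ ?_
  have hw : β (b a) w = ∑ c, b.coord c w * β (b a) (b c) := by
    conv_lhs => rw [← b.sum_repr w]
    simp only [map_sum, map_smul, smul_eq_mul, Basis.coord_apply]
  rw [hw, Finset.mul_sum]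
  exact Finset.sum_congr rfl fun c _ ↦ by ring

end Helpers

namespace IsMetricOn

variable {G : E → E →L[ℝ] E →L[ℝ] ℝ} {V : Set E} {x : E} {ι : Type*} [Fintype ι] (b : Basis ι ℝ E)

/-- **The Bochner formula for a field of symmetric bilinear forms**:
`Δ|β|² = 2|∇β|² + 2⟨β, Δβ⟩` for `β ∈ C^∞(V)` symmetric, where
`|∇β|²_x = Σ_{kl} g^{kl} ⟨∇_{b_k}β, ∇_{b_l}β⟩_G` and `Δβ = lapBilinAt G β` is the rough Laplacian
(Hamilton 1982, §7, the computation behind Lemma 7.4 / Lemma 11.2: contractions commute with `∇`,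
`Δ(β ∗ β) = 2 ∇β ∗ ∇β + 2 β ∗ Δβ`). This is `IsMetricOn.lapAt_quadratic` with `c = 0`.
[cite: Hamilton1982, §7] -/
theorem lapAt_normSqAt (hG : IsMetricOn G V) (hx : x ∈ V) {β : E → E →L[ℝ] E →L[ℝ] ℝ}
    (hβ : ContDiffOn ℝ ∞ β V) (hs : ∀ y ∈ V, ∀ v w, β y v w = β y w v) :
    lapAt G (fun y ↦ normSqAt G y (β y)) x =
      2 * (∑ k, ∑ l, ginv G b x k l * pairAt G x (cov₂At G β x (b k)) (cov₂At G β x (b l)))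
        + 2 * pairAt G x (β x) (lapBilinAt G β x) := by
  have hP := hG.lapAt_quadratic (c := 0) hx hβ b
  have hev : (fun y ↦ normSqAt G y (β y)) =ᶠ[𝓝 x]
      fun y ↦ (-2) * (1 / 2 * (0 * mtrAt G y (β y) ^ 2 - pairAt G y (β y) (β y))) := by
    filter_upwards [hG.mem_nhds hx] with y hy
    rw [← pairAt_self_of_symm G y (hs y hy)]
    ring
  have hC2 : ContDiffAt ℝ 2
      (fun y ↦ 1 / 2 * (0 * mtrAt G y (β y) ^ 2 - pairAt G y (β y) (β y))) x :=
    contDiffAt_two_of_contDiffOn hG.isOpen (hG.contDiffOn_quadratic hβ) hx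
  rw [lapAt_congr_of_eventuallyEq G hev, lapAt_const_mul G hC2, hP]
  have hlap : lapBilinAt G β x =
      ∑ k, ∑ l, ginv G b x k l • cov₃At G (cov₂At G β) x (b k) (b l) := by
    ext Y Z
    simp only [lapBilinAt_apply_eq_sum G β b, FunLike.coe_sum, Finset.sum_apply,
      _root_.smul_apply, smul_eq_mul]
  rw [hlap, pairAt_sum_right]
  simp only [pairAt_sum_right, pairAt_smul_right, zero_mul, zero_sub, mul_neg,
    Finset.sum_neg_distrib]
  ring

end IsMetricOn

/-! ### The evolution of `|Ric|²` under the Ricci flow -/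

namespace IsMetricFamilyOn

section RicciFlow

variable {G : ℝ → E → E →L[ℝ] E →L[ℝ] ℝ} {S : Set ℝ} {V : Set E} {x : E} {t : ℝ}
  {ι : Type*} [Fintype ι] (b : Basis ι ℝ E)
  (hG : IsMetricFamilyOn G S V)
  (hfl : ∀ s ∈ S, ∀ y ∈ V, tDeriv G S s y = (-2 : ℝ) • ricAt (G s) y)
include hG hfl

/-- **Evolution of `|Ric|²` under the Ricci flow, in coordinates** (Hamilton 1982, Lemma 11.2,
from Cor. 7.3: `∂ₜ|R_{ij}|² = Δ|R_{ij}|² − 2|∇_k R_{ij}|² + 4 R_{piqj}R_{pq}R_{ij}`). Let `G` be a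
smooth one-parameter family of metric components on `V × S` with `∂G/∂t = −2 Ric(G)` on `V × S`.
Then at `t ∈ S`, `x ∈ V`, in any basis `b`, `s ↦ |Ric(G s)|²_x` has derivative within `S`

`Δ|Ric|² − 2 Σ_{kl} g^{kl}⟨∇_{b_k}Ric, ∇_{b_l}Ric⟩ + 4 B(Ric, Ric)`,

`B_x(β, γ) = Σᵢⱼ g^{ij} Σ_k bᵏ(♯((β.flip bⱼ) ∘ R(bᵢ, ♯(γ b_k))))` the curvature pairing
(`= Σ g^{ij}⟨(Y,Z) ↦ β(R(bᵢ,Y)Z, bⱼ), γ⟩_G`). [cite: Hamilton1982, §11, Lemma 11.2] -/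
theorem hasDerivWithinAt_normSqAt_ricAt_ricciFlow (hx : x ∈ V) (ht : t ∈ S) :
    HasDerivWithinAt (fun s ↦ normSqAt (G s) x (ricAt (G s) x))
      (lapAt (G t) (fun y ↦ normSqAt (G t) y (ricAt (G t) y)) x
        - 2 * (∑ k, ∑ l, ginv (G t) b x k l *
            pairAt (G t) x (cov₂At (G t) (ricAt (G t)) x (b k))
              (cov₂At (G t) (ricAt (G t)) x (b l)))
        + 4 * (∑ i, ∑ j, ginv (G t) b x i j * ∑ k, b.coord k (sharpAt (G t) x
            (((ricAt (G t) x).flip (b j)).comp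
              (riemAt (G t) x (b i) (sharpAt (G t) x (ricAt (G t) x (b k)))))))) S t := by
  have hGt := hG.isMetricOn t ht
  have hi := hGt.isInvertible x hx
  have hU := hG.uniqueDiffOn t ht
  have hRs : ∀ v w, ricAt (G t) x v w = ricAt (G t) x w v := hGt.ricAt_comm hx
  -- a CLM-valued derivative of `s ↦ Ric(G s)_x` within `S`, by expansion in the dual basis
  obtain ⟨κ, hK⟩ : ∃ κ, HasDerivWithinAt (fun s ↦ ricAt (G s) x) κ S t := by
    have hexp : (fun s ↦ ricAt (G s) x) = fun s ↦ ∑ a, ∑ c,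
        ricAt (G s) x (b a) (b c) • (coordCLM b a).smulRight (coordCLM b c) :=
      funext fun s ↦ eq_sum_smul_coordCLM_smulRight b (ricAt (G s) x)
    rw [hexp]
    exact ⟨_, HasDerivWithinAt.fun_sum fun a _ ↦ HasDerivWithinAt.fun_sum fun c _ ↦
      (hG.hasDerivWithinAt_ricAt_ricciFlow' b hfl hx ht (b a) (b c)).smul_const _⟩
  -- its components are the scalar derivatives (uniqueness of derivatives within `S`)
  have hcomp : ∀ Y Z, HasDerivWithinAt (fun s ↦ ricAt (G s) x Y Z) (κ Y Z) S t := by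
    intro Y Z
    have h1 := hK.clm_apply (hasDerivWithinAt_const t S Y)
    simp only [map_zero, add_zero] at h1
    have h2 := h1.clm_apply (hasDerivWithinAt_const t S Z)
    simpa using h2
  have hκ : ∀ Y Z, κ Y Z = lapBilinAt (G t) (ricAt (G t)) x Y Z
      + 2 * ∑ i, ∑ j, ginv (G t) b x i j * ricAt (G t) x (riemAt (G t) x (b i) Y Z) (b j)
      - 2 * ∑ k, ∑ l, ginv (G t) b x k l * (ricAt (G t) x Y (b k) * ricAt (G t) x Z (b l)) :=
    fun Y Z ↦ hU.eq_deriv _ (hcomp Y Z) (hG.hasDerivWithinAt_ricAt_ricciFlow' b hfl hx ht Y Z)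
  have hκs : ∀ v w, κ v w = κ w v := by
    intro v w
    refine hU.eq_deriv _ (hcomp v w) ((hcomp w v).congr (fun s hs ↦ ?_) ?_)
    · exact (hG.isMetricOn s hs).ricAt_comm hx v w
    · exact hRs v w
  have hmain := hG.hasDerivWithinAt_normSqAt hx ht hK hRs hκs
  refine hmain.congr_deriv ?_
  rw [hGt.lapAt_normSqAt b hx hGt.contDiffOn_ricAt (fun y hy ↦ hGt.ricAt_comm hy), hfl t ht x hx]
  -- the three contractions of `κ` against `Ric`: `⟨ΔRic, Ric⟩`, the curvature pairing, `tr (♯Ric)³`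
  have hT1 : ∑ k, ∑ j, ginv (G t) b x k j *
      lapBilinAt (G t) (ricAt (G t)) x (sharpAt (G t) x (ricAt (G t) x (b k))) (b j) =
      pairAt (G t) x (ricAt (G t) x) (lapBilinAt (G t) (ricAt (G t)) x) := by
    rw [pairAt_comm, pairAt_eq_sum_ginv b]
  have hQ : ∀ Y Z, ∑ m, ∑ n, ginv (G t) b x m n * (ricAt (G t) x Y (b m) * ricAt (G t) x Z (b n)) =
      ((ricAt (G t) x).comp ((sharpAt (G t) x).comp (ricAt (G t) x))) Y Z := by
    intro Y Z
    rw [ContinuousLinearMap.comp_apply, ContinuousLinearMap.comp_apply,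
      hRs (sharpAt (G t) x (ricAt (G t) x Y)) Z]
    conv_rhs => rw [← b.sum_repr (sharpAt (G t) x (ricAt (G t) x Y))]
    simp only [map_sum, map_smul, smul_eq_mul, ← Basis.coord_apply]
    simp only [coord_sharpAt_eq_sum b, Finset.sum_mul]
    rw [Finset.sum_comm]
    refine Finset.sum_congr rfl fun n _ ↦ Finset.sum_congr rfl fun m _ ↦ ?_
    rw [ginv_comm b hi (hGt.symm x hx) n m]
    ring
  have hT3 : ∑ k, ∑ j, ginv (G t) b x k j *
      (∑ m, ∑ n, ginv (G t) b x m n * (ricAt (G t) x (sharpAt (G t) x (ricAt (G t) x (b k))) (b m)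
        * ricAt (G t) x (b j) (b n))) =
      traceCLM E ((((sharpAt (G t) x).comp (ricAt (G t) x)).comp
        ((sharpAt (G t) x).comp (ricAt (G t) x))).comp
          ((sharpAt (G t) x).comp (ricAt (G t) x))) := by
    simp only [hQ]
    rw [← pairAt_eq_sum_ginv b ((ricAt (G t) x).comp ((sharpAt (G t) x).comp (ricAt (G t) x)))
      (ricAt (G t) x), pairAt_apply]
    simp only [ContinuousLinearMap.comp_assoc]
  have hT2 : ∑ k, ∑ j, ginv (G t) b x k j *
      (∑ i, ∑ l, ginv (G t) b x i l * ricAt (G t) x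
        (riemAt (G t) x (b i) (sharpAt (G t) x (ricAt (G t) x (b k))) (b j)) (b l)) =
      ∑ i, ∑ l, ginv (G t) b x i l * ∑ k, b.coord k (sharpAt (G t) x
        (((ricAt (G t) x).flip (b l)).comp
          (riemAt (G t) x (b i) (sharpAt (G t) x (ricAt (G t) x (b k)))))) := by
    simp only [coord_sharpAt_eq_sum b, ContinuousLinearMap.comp_apply,
      ContinuousLinearMap.flip_apply, Finset.mul_sum]
    rw [sum_comm_pairs]
    refine Finset.sum_congr rfl fun i _ ↦ Finset.sum_congr rfl fun l _ ↦
      Finset.sum_congr rfl fun k _ ↦ Finset.sum_congr rfl fun j _ ↦ ?_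
    ring
  have e1 : pairAt (G t) x κ (ricAt (G t) x) =
      pairAt (G t) x (ricAt (G t) x) (lapBilinAt (G t) (ricAt (G t)) x)
      + 2 * (∑ i, ∑ l, ginv (G t) b x i l * ∑ k, b.coord k (sharpAt (G t) x
          (((ricAt (G t) x).flip (b l)).comp
            (riemAt (G t) x (b i) (sharpAt (G t) x (ricAt (G t) x (b k)))))))
      - 2 * traceCLM E ((((sharpAt (G t) x).comp (ricAt (G t) x)).comp
          ((sharpAt (G t) x).comp (ricAt (G t) x))).comp
            ((sharpAt (G t) x).comp (ricAt (G t) x))) := by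
    rw [pairAt_eq_sum_ginv b κ (ricAt (G t) x), ← hT1, ← hT2, ← hT3]
    have hterm : ∀ k j, ginv (G t) b x k j * κ (sharpAt (G t) x (ricAt (G t) x (b k))) (b j) =
        ginv (G t) b x k j *
          lapBilinAt (G t) (ricAt (G t)) x (sharpAt (G t) x (ricAt (G t) x (b k))) (b j)
        + 2 * (ginv (G t) b x k j * ∑ i, ∑ l, ginv (G t) b x i l * ricAt (G t) x
            (riemAt (G t) x (b i) (sharpAt (G t) x (ricAt (G t) x (b k))) (b j)) (b l))
        - 2 * (ginv (G t) b x k j * ∑ m, ∑ n, ginv (G t) b x m n *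
            (ricAt (G t) x (sharpAt (G t) x (ricAt (G t) x (b k))) (b m)
              * ricAt (G t) x (b j) (b n))) := by
      intro k j
      rw [hκ]
      ring
    simp only [hterm, Finset.sum_add_distrib, Finset.sum_sub_distrib, ← Finset.mul_sum]
  have e2 : traceCLM E ((((sharpAt (G t) x).comp ((-2 : ℝ) • ricAt (G t) x)).comp
      ((sharpAt (G t) x).comp (ricAt (G t) x))).comp ((sharpAt (G t) x).comp (ricAt (G t) x))) =
      (-2) * traceCLM E ((((sharpAt (G t) x).comp (ricAt (G t) x)).comp
        ((sharpAt (G t) x).comp (ricAt (G t) x))).comp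
          ((sharpAt (G t) x).comp (ricAt (G t) x))) := by
    simp only [ContinuousLinearMap.comp_smul, ContinuousLinearMap.smul_comp, map_smul, smul_eq_mul]
  rw [e2]
  linear_combination 2 * e1

end RicciFlow

end IsMetricFamilyOn

end MetricCoord

end Literature.Geometry.Lorentzian

end
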